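import Mathlib
import Literature.Probability.RandomPlanarGeometry.ConformalMap
import Summits.CriticalPhenomena.SAWScalingLimit.Theorems.SAWDefectDecoherenceObservableToSLEROrientation
import Summits.CriticalPhenomena.SAWScalingLimit.Theorems.SAWDefectDecoherenceObservableToSLERGateDefs

/-!
# The `60°` face rotation of the honeycomb lattice (line `bridge-gate-renewal` of the crux
`SAWDefectDecoherence.ObservableToSLER`, stmt-CriticalPhenomena-14005; helper 1 of stub 3a
`stub_orientationCoOriented`, reshape r4)

Stub 3a of the lead's skeleton transports the route hypothesis `HexObservableLimitR` (orientation
class `(0, 0)`: horizontal flat pieces, domain above, at both marked points) to the six CO-ORIENTED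
classes `(j, j)`, `j : Fin 6`, by the global lattice rotation `z ↦ ζ^{-j} z` (`ζ = triZeta = e^{iπ/3}`).
This file DEFINES the lattice side of that rotation and nothing else:

* `hexRot60` / `hexRotNeg60` — the `±60°` rotation of honeycomb FACES about the origin (a vertex of
  `𝕋` = centre of a honeycomb hexagon): the up triangle of cell `x` goes to the down triangle of cell
  `R x − e₀`, the down triangle to the up triangle of cell `R x − e₀ + e₁` (`R (a, b) = (−b, a + b)`);
  `hexRot60Equiv`, `hexRot60Iso : hexGraph ≃g hexGraph` (a graph automorphism,
  `hexGraph_adj_hexRot60_iff`) with the equivariance `hexCenter (σ v) = ζ · hexCenter v`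
  (`hexCenter_hexRot60`);
* `hexRotIso n = σ^n` (iterate), `hexCenter_hexRotIso : hexCenter (σ^n v) = ζ^n · hexCenter v`,
  `hexCenter_hexRotIso_symm : hexCenter (σ^{-n} v) = conj(ζ^n) · hexCenter v`;
* the SHIFT TABLE of the signed rows (`rowOf`, from `…Orientation.lean`) under the rotation:
  `rowOf (k + 1) (σ v) = rowOf k v + (1, 0, 0, −1, 0, 0)_k` (`rowOf_succ_hexRot60`) and, iterated,
  `rowOf j (σ^j v) = rowOf 0 v + (0, 1, 1, 1, 0, 0)_j` (`rowOf_hexRotIso`): the lattice clause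
  `m ≤ rowOf j ·` of class `(j, j)` is, after rotating back by `σ^{-j}`, `R`'s clause
  `m − c_j ≤ (·).1 1`;
* `rotCE Φ u hu U₀ hU₀` — the precomposition `z ↦ Φ (u z)` of a conformal equivalence
  `Φ : U → V` with the similarity `z ↦ u z` (`u ≠ 0`), as a conformal equivalence `U₀ → V` for any
  set `U₀` with `z ∈ U₀ ↔ u z ∈ U` (the rotated uniformiser of stub 3a).

Registered bookkeeping theorem: `stub_coOrientedLattice` (equivariance + iterated shift table).
Sources: H. Duminil-Copin, S. Smirnov, Ann. of Math. 175 (2012) (arXiv:1007.0575) §2 (honeycomb =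
faces of `𝕋`); refuter audit `Cruxes/ObservableToSLER/Disproof.lean` §8 ("co-tilted pairs need the
provable `60°`-rotation covariance"); pattern `Theorems/HexObservableLimitR/Negative/Mirror.lean`.
-/

noncomputable section

open scoped BigOperators Topology ComplexConjugate
open Set
open Literature.Probability.LatticeModels (HexVertex hexGraph hexCenter triZeta triEmbed Site
  triZeta_sq normSq_triZeta)
open Literature.Probability.RandomPlanarGeometry
open Literature.Probability.RandomPlanarGeometry.SAW

namespace Summit.CriticalPhenomena.SAWScalingLimit.Theorems.ObservableToSLER.BridgeGate

/-! ### The `60°` rotation of honeycomb faces about the origin -/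

/-- The `+60°` rotation of honeycomb faces about the origin: the up triangle of cell `x` goes to the
down triangle of cell `R x − e₀`, the down triangle of cell `x` to the up triangle of cell
`R x − e₀ + e₁` (`R (a, b) = (−b, a + b)` = `triRot60`). -/
def hexRot60 (v : HexVertex) : HexVertex :=
  (![-v.1 1 - 1, v.1 0 + v.1 1 + ((v.2 : ℕ) : ℤ)], 1 - v.2)

/-- Its inverse, the `−60°` rotation of faces about the origin. -/
def hexRotNeg60 (v : HexVertex) : HexVertex :=
  (![v.1 0 + v.1 1 + ((v.2 : ℕ) : ℤ), -v.1 0 - 1], 1 - v.2)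

/-- `σ⁻¹ ∘ σ = id`. -/
@[simp] theorem hexRotNeg60_hexRot60 (v : HexVertex) : hexRotNeg60 (hexRot60 v) = v := by
  obtain ⟨x, t⟩ := v
  fin_cases t <;> refine Prod.ext ?_ (by simp [hexRot60, hexRotNeg60]) <;> ext i <;>
    fin_cases i <;> (simp [hexRot60, hexRotNeg60]; try ring)

/-- `σ ∘ σ⁻¹ = id`. -/
@[simp] theorem hexRot60_hexRotNeg60 (v : HexVertex) : hexRot60 (hexRotNeg60 v) = v := by
  obtain ⟨x, t⟩ := v
  fin_cases t <;> refine Prod.ext ?_ (by simp [hexRot60, hexRotNeg60]) <;> ext i <;>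
    fin_cases i <;> (simp [hexRot60, hexRotNeg60]; try ring)

/-- The face rotation as a permutation of `HexVertex`. -/
def hexRot60Equiv : HexVertex ≃ HexVertex where
  toFun := hexRot60
  invFun := hexRotNeg60
  left_inv := hexRotNeg60_hexRot60
  right_inv := hexRot60_hexRotNeg60

/-- `hexRot60Equiv` is `hexRot60` on points. -/
@[simp] theorem hexRot60Equiv_apply (v : HexVertex) : hexRot60Equiv v = hexRot60 v := rfl

/-- **Equivariance of face centres:** `c(σ v) = ζ · c(v)`. -/
theorem hexCenter_hexRot60 (v : HexVertex) : hexCenter (hexRot60 v) = triZeta * hexCenter v := by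
  obtain ⟨x, t⟩ := v
  have h := triZeta_sq
  fin_cases t
  · simp [hexCenter, triEmbed, hexRot60]
    linear_combination (-(x 1 : ℂ) - 1 / 3) * h
  · simp [hexCenter, triEmbed, hexRot60]
    linear_combination (-(x 1 : ℂ) - 2 / 3) * h

/-- **The face rotation is a graph automorphism of the honeycomb lattice.** -/
theorem hexGraph_adj_hexRot60_iff (u v : HexVertex) :
    hexGraph.Adj (hexRot60 u) (hexRot60 v) ↔ hexGraph.Adj u v := by
  obtain ⟨x, i⟩ := u
  obtain ⟨y, j⟩ := v
  fin_cases i <;> fin_cases j <;>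
    simp only [hexRot60, hexGraph_adj_iff_coord] <;> simp <;> omega

/-- The face rotation as a graph automorphism of `hexGraph`. -/
def hexRot60Iso : hexGraph ≃g hexGraph where
  toEquiv := hexRot60Equiv
  map_rel_iff' := fun {a b} => hexGraph_adj_hexRot60_iff a b

/-- `hexRot60Iso` is `hexRot60` on points. -/
@[simp] theorem hexRot60Iso_apply (v : HexVertex) : hexRot60Iso v = hexRot60 v := rfl

/-- **Shift table of the signed rows under the face rotation:**
`rowOf (k + 1) (σ v) = rowOf k v + (1, 0, 0, −1, 0, 0)_k`. -/
theorem rowOf_succ_hexRot60 (k : Fin 6) (v : HexVertex) :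
    rowOf (k + 1) (hexRot60 v) = rowOf k v + (![1, 0, 0, -1, 0, 0] : Fin 6 → ℤ) k := by
  obtain ⟨x, t⟩ := v
  fin_cases k <;> fin_cases t <;> simp [rowOf, rowCoord, hexRot60] <;> omega

/-! ### Iterated rotations `σ^n` -/

/-- The `n`-fold face rotation `σ^n` (rotation by `n · 60°` about the origin) as a graph
automorphism of `hexGraph`. -/
def hexRotIso : ℕ → hexGraph ≃g hexGraph
  | 0 => RelIso.refl _
  | n + 1 => (hexRotIso n).trans hexRot60Iso

/-- `σ^0 = id`. -/
@[simp] theorem hexRotIso_zero_apply (v : HexVertex) : hexRotIso 0 v = v := rfl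

/-- `σ^{n+1} = σ ∘ σ^n`. -/
theorem hexRotIso_succ_apply (n : ℕ) (v : HexVertex) :
    hexRotIso (n + 1) v = hexRot60 (hexRotIso n v) := rfl

/-- **Equivariance of face centres under `σ^n`:** `c(σ^n v) = ζ^n · c(v)`. -/
theorem hexCenter_hexRotIso (n : ℕ) (v : HexVertex) :
    hexCenter (hexRotIso n v) = triZeta ^ n * hexCenter v := by
  induction n with
  | zero => simp
  | succ n ih => rw [hexRotIso_succ_apply, hexCenter_hexRot60, ih, pow_succ]; ring

/-- `‖ζ^n‖ = 1`. -/
theorem norm_triZeta_pow (n : ℕ) : ‖triZeta ^ n‖ = 1 := by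
  have h : ‖triZeta‖ = 1 := by
    have h2 : ‖triZeta‖ ^ 2 = 1 := by rw [Complex.sq_norm, normSq_triZeta]
    nlinarith [norm_nonneg triZeta]
  rw [norm_pow, h, one_pow]

/-- `ζ^n ≠ 0`. -/
theorem triZeta_pow_ne_zero (n : ℕ) : triZeta ^ n ≠ 0 :=
  norm_ne_zero_iff.1 (by rw [norm_triZeta_pow]; exact one_ne_zero)

/-- `conj(ζ^n) · ζ^n = 1`. -/
theorem conj_triZeta_pow_mul_self (n : ℕ) : conj (triZeta ^ n) * triZeta ^ n = 1 := by
  rw [← Complex.inv_eq_conj (norm_triZeta_pow n), inv_mul_cancel₀ (triZeta_pow_ne_zero n)]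

/-- `ζ^n · conj(ζ^n) = 1`. -/
theorem triZeta_pow_mul_conj_self (n : ℕ) : triZeta ^ n * conj (triZeta ^ n) = 1 := by
  rw [mul_comm, conj_triZeta_pow_mul_self]

/-- **Equivariance of face centres under `σ^{-n}`:** `c(σ^{-n} v) = conj(ζ^n) · c(v)`. -/
theorem hexCenter_hexRotIso_symm (n : ℕ) (v : HexVertex) :
    hexCenter ((hexRotIso n).symm v) = conj (triZeta ^ n) * hexCenter v := by
  have h := hexCenter_hexRotIso n ((hexRotIso n).symm v)
  rw [RelIso.apply_symm_apply] at h
  rw [h, ← mul_assoc, conj_triZeta_pow_mul_self, one_mul]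

/-- The same in the affine normal form `c(T f) = α · c(f) + β` used by the transport lemmas of
`…InteriorFlatteningLiouvilleTransportA` (`α = conj(ζ^n)`, `β = 0`). -/
theorem hexCenter_hexRotIso_symm_affine (n : ℕ) (f : HexVertex) :
    hexCenter ((hexRotIso n).symm f) = conj (triZeta ^ n) * hexCenter f + 0 := by
  rw [hexCenter_hexRotIso_symm, add_zero]

/-- **Iterated shift table:** `rowOf j (σ^j v) = rowOf 0 v + (0, 1, 1, 1, 0, 0)_j` for `j : Fin 6` —
the lattice clause `m ≤ rowOf j ·` of the co-oriented class `(j, j)` pulls back under `σ^j` to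
`R`'s clause `m − c_j ≤ rowOf 0 · = (·).1 1`. -/
theorem rowOf_hexRotIso (j : Fin 6) (v : HexVertex) :
    rowOf j (hexRotIso (j : ℕ) v) = rowOf 0 v + (![0, 1, 1, 1, 0, 0] : Fin 6 → ℤ) j := by
  have h1 : ∀ w, rowOf 1 (hexRot60 w) = rowOf 0 w + 1 := fun w => by
    simpa using rowOf_succ_hexRot60 0 w
  have h2 : ∀ w, rowOf 2 (hexRot60 w) = rowOf 1 w := fun w => by
    simpa using rowOf_succ_hexRot60 1 w
  have h3 : ∀ w, rowOf 3 (hexRot60 w) = rowOf 2 w := fun w => by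
    simpa using rowOf_succ_hexRot60 2 w
  have h4 : ∀ w, rowOf 4 (hexRot60 w) = rowOf 3 w - 1 := fun w => by
    simpa [sub_eq_add_neg] using rowOf_succ_hexRot60 3 w
  have h5 : ∀ w, rowOf 5 (hexRot60 w) = rowOf 4 w := fun w => by
    simpa using rowOf_succ_hexRot60 4 w
  fin_cases j <;> simp [hexRotIso_succ_apply, h1, h2, h3, h4, h5]

/-- Membership in the image of a vertex set under `σ^{-n}`, through `σ^n`. -/
theorem mem_image_hexRotIso_symm_iff (n : ℕ) (Λ : Finset HexVertex) (w : HexVertex) :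
    w ∈ Λ.image (hexRotIso n).symm ↔ hexRotIso n w ∈ Λ := by
  rw [Finset.mem_image]
  constructor
  · rintro ⟨v, hv, rfl⟩
    rwa [RelIso.apply_symm_apply]
  · intro h
    exact ⟨hexRotIso n w, h, RelIso.symm_apply_apply _ w⟩

/-! ### Precomposition of a conformal equivalence with a similarity `z ↦ u z` -/

/-- **The rotated uniformiser.**  For a conformal equivalence `Φ : U → V`, a unit `u ≠ 0` and a set
`U₀` with `z ∈ U₀ ↔ u z ∈ U` (i.e. `U₀ = u⁻¹ U`), the map `z ↦ Φ (u z)` is a conformal equivalence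
`U₀ → V` with inverse `w ↦ u⁻¹ Φ⁻¹ w`. -/
def rotCE {U V : Set ℂ} (Φ : ConformalEquiv U V) (u : ℂ) (hu : u ≠ 0) (U₀ : Set ℂ)
    (hU₀ : ∀ z, z ∈ U₀ ↔ u * z ∈ U) : ConformalEquiv U₀ V where
  toFun z := Φ (u * z)
  invFun w := u⁻¹ * Φ.symm w
  source := U₀
  target := V
  map_source' z hz := Φ.mapsTo ((hU₀ z).1 hz)
  map_target' w hw := (hU₀ _).2 (by rw [mul_inv_cancel_left₀ hu]; exact Φ.symm_mapsTo hw)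
  left_inv' z hz := by
    show u⁻¹ * Φ.symm (Φ (u * z)) = z
    rw [Φ.symm_apply_apply ((hU₀ z).1 hz), inv_mul_cancel_left₀ hu]
  right_inv' w hw := by
    show Φ (u * (u⁻¹ * Φ.symm w)) = w
    rw [mul_inv_cancel_left₀ hu, Φ.apply_symm_apply hw]
  source_eq := rfl
  target_eq := rfl
  differentiableOn :=
    Φ.differentiableOn.comp (differentiableOn_id.const_mul u) fun z hz => (hU₀ z).1 hz
  differentiableOn_symm := Φ.symm.differentiableOn.const_mul u⁻¹

/-- `rotCE Φ u … z = Φ (u z)`. -/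
@[simp] theorem rotCE_apply {U V : Set ℂ} (Φ : ConformalEquiv U V) (u : ℂ) (hu : u ≠ 0)
    (U₀ : Set ℂ) (hU₀ : ∀ z, z ∈ U₀ ↔ u * z ∈ U) (z : ℂ) : rotCE Φ u hu U₀ hU₀ z = Φ (u * z) :=
  rfl

/-- The rotated uniformiser as a function is `Φ ∘ (u · )`. -/
theorem coe_rotCE {U V : Set ℂ} (Φ : ConformalEquiv U V) (u : ℂ) (hu : u ≠ 0) (U₀ : Set ℂ)
    (hU₀ : ∀ z, z ∈ U₀ ↔ u * z ∈ U) : (rotCE Φ u hu U₀ hU₀ : ℂ → ℂ) = fun z => Φ (u * z) :=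
  rfl

/-- `(rotCE Φ u …)⁻¹ w = u⁻¹ Φ⁻¹ w`. -/
theorem rotCE_symm_apply {U V : Set ℂ} (Φ : ConformalEquiv U V) (u : ℂ) (hu : u ≠ 0)
    (U₀ : Set ℂ) (hU₀ : ∀ z, z ∈ U₀ ↔ u * z ∈ U) (w : ℂ) :
    (rotCE Φ u hu U₀ hU₀).symm w = u⁻¹ * Φ.symm w :=
  rfl

/-! ### Registered bookkeeping theorem -/

/-- **REGISTERED SUB-GOAL `stub_coOrientedLattice` (helper 1 of stub 3a `stub_orientationCoOriented`,
line `bridge-gate-renewal`, reshape r4):** the `n`-fold face rotation acts on face centres by `ζ^n`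
and shifts the signed rows by the table `(0, 1, 1, 1, 0, 0)`:
`hexCenter (σ^j v) = ζ^j · hexCenter v` and `rowOf j (σ^j v) = rowOf 0 v + (0, 1, 1, 1, 0, 0)_j`. -/
theorem stub_coOrientedLattice :
    ∀ (j : Fin 6) (v : HexVertex),
      hexCenter (hexRotIso (j : ℕ) v) = triZeta ^ (j : ℕ) * hexCenter v ∧
        rowOf j (hexRotIso (j : ℕ) v) = rowOf 0 v + (![0, 1, 1, 1, 0, 0] : Fin 6 → ℤ) j :=
  fun j v => ⟨hexCenter_hexRotIso _ v, rowOf_hexRotIso j v⟩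

end Summit.CriticalPhenomena.SAWScalingLimit.Theorems.ObservableToSLER.BridgeGate

end
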